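import Mathlib
import Summits.MatrixMultiplication.MatrixMultiplication.Theorems.SubgroupIdentityDesigns.Negative.BorelLevelOne

/-!
# The potential criterion: Theorem H, PASS direction, for every subset of a Borel of `GL₂(𝔽_p)`
(positive instance lemma for the identity-design clause of the crux `SubgroupIdentityDesigns`,
stmt-MatrixMultiplication-14079; cell B2b-5, gen 6 — report
`run/shared/lean/b2b/levelgraded-cu/ORACLE-g6.md` §G6-1)

Let `S` be a set of upper-triangular elements `s = [[x, y], [0, z]]` of `GL₂(𝔽_p)`.  A POTENTIAL for `S`
is a pair `φ, η : 𝔽_p → ℂ` with `φ(1) + η(1) = 1` together with a section `y₀(x,z)` (`y₀(1,1) = 0`)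
such that every `s ∈ S ∖ {1}` lying on the section (`y = y₀(x,z)`) has `φ(x) + η(z) = 0` — i.e.
`φ(x) + η(z)` vanishes on every FULL unipotent coset inside `S` other than that of `1`, and `y₀` picks
a missing point on the other cosets.  Then `S` passes the level-one identity test, with the explicit
level-one witness `f(s) = (φ(x) + η(z))·[y = y₀(x,z)]` on upper-triangular `s` (`potFn_upper`):
`f = p⁻¹ Σ_{u,x',z'} (φ(x')+η(z'))·[g(u,1)ᵀ = (x'u + y₀(x',z'), z')ᵀ] − p⁻¹ Σφ − p⁻¹(p−1)·η(z) + p⁻¹ φ(x)`,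
a combination of FRAME INDICATORS `[g U₀ = W₀]` (level `1` by the landed frame duality), using
`#{u : xu + y = x'u + t} = 1` for `x ≠ x'`.
* `idTest_of_borel_potential` — the test passes (matrix-free, `S ⊆ GL₂`);
* `levelOne_idDesign_of_borel_potential` — the literal design clause of the crux at `(m,k) = (2,1)`
  for upper-triangular subgroups `H₁, H₂, H₃` admitting a potential.
With `BorelLevelOne` (a missing unipotent ⇒ PASS) and `BorelGhost` (a ghost, e.g. a coset cycle through
`(1,1)`, ⇒ FAIL) this certifies every case of the cell's THEOREM H: PASS iff the coset `(1,1)` is not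
full in `S` or is a bridge of the graph of full cosets (bridge ⇒ the two sides of the cut give a
potential).  Sorry-free; axioms `propext`, `Classical.choice`, `Quot.sound`.  VALUE = a certificate
format for the finite frontier of the crux, NOT summit progress; the crux item stays open.
-/

set_option linter.dupNamespace false

noncomputable section

open scoped BigOperators Classical
open Summit.MatrixMultiplication.MatrixMultiplication.Theorems.LieRankDesigns.Negative
  (GLm Mat fourierFn RankSupp levelSet constCoeff rankSupp_constCoeff fourierFn_constCoeff)
open Summit.MatrixMultiplication.MatrixMultiplication.Theorems.LieRankDesigns.LevelOfFixedVector
  (add_mem_levelSet smul_mem_levelSet sum_mem_levelSet)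

namespace Summit.MatrixMultiplication.MatrixMultiplication.Theorems.SubgroupIdentityDesigns.Negative

variable {p : ℕ} [Fact p.Prime]

section Potential

/-- The column `(a, b)ᵀ ∈ M_{2×1}(𝔽_p)`. -/
def bcol (a b : ZMod p) : Matrix (Fin 2) (Fin 1) (ZMod p) := !![a; b]

omit [Fact p.Prime] in
/-- Top entry of `(a, b)ᵀ`. -/
@[simp] theorem bcol_zero (a b : ZMod p) : bcol a b 0 0 = a := rfl

omit [Fact p.Prime] in
/-- Bottom entry of `(a, b)ᵀ`. -/
@[simp] theorem bcol_one (a b : ZMod p) : bcol a b 1 0 = b := rfl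

/-- For upper triangular `s = [[x, y], [0, z]]`: `s (u,1)ᵀ = (v,t)ᵀ ↔ xu + y = v ∧ z = t`. -/
theorem mul_affCol_eq_bcol_iff (s : Mat p 2) (hs : s 1 0 = 0) (u v t : ZMod p) :
    s * affCol u = bcol v t ↔ s 0 0 * u + s 0 1 = v ∧ s 1 1 = t := by
  have e0 : (s * affCol u) 0 0 = s 0 0 * u + s 0 1 := by
    simp [Matrix.mul_apply, Fin.sum_univ_two]
  have e1 : (s * affCol u) 1 0 = s 1 1 := by
    simp [Matrix.mul_apply, Fin.sum_univ_two, hs]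
  constructor
  · intro h
    exact ⟨by rw [← e0, h, bcol_zero], by rw [← e1, h, bcol_one]⟩
  · rintro ⟨h0, h1⟩
    ext i j
    fin_cases i <;> fin_cases j
    · simpa [e0] using h0
    · simpa [e1] using h1

/-- For upper triangular `s`: `s (1,0)ᵀ = (v,0)ᵀ ↔ x = v`. -/
theorem mul_bcol_eq_iff (s : Mat p 2) (hs : s 1 0 = 0) (v : ZMod p) :
    s * bcol (1 : ZMod p) 0 = bcol v 0 ↔ s 0 0 = v := by
  have e0 : (s * bcol (1 : ZMod p) 0) 0 0 = s 0 0 := by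
    simp [Matrix.mul_apply, Fin.sum_univ_two]
  have e1 : (s * bcol (1 : ZMod p) 0) 1 0 = 0 := by
    simp [Matrix.mul_apply, Fin.sum_univ_two, hs]
  constructor
  · intro h
    rw [← e0, h, bcol_zero]
  · intro h0
    ext i j
    fin_cases i <;> fin_cases j
    · simpa [e0] using h0
    · simp [e1]

/-- `#{u : xu + y = x'u + t} = 1` when `x ≠ x'`. -/
theorem sum_ite_line_of_ne {x x' : ZMod p} (hx : x ≠ x') (y t : ZMod p) :
    ∑ u : ZMod p, (if x * u + y = x' * u + t then (1 : ℂ) else 0) = 1 := by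
  have hd : x - x' ≠ 0 := sub_ne_zero.mpr hx
  have key : ∀ u : ZMod p, (x * u + y = x' * u + t) ↔ u = (t - y) / (x - x') := by
    intro u
    rw [eq_div_iff hd]
    constructor
    · intro h; linear_combination h
    · intro h; linear_combination h
  simp_rw [key, Finset.sum_ite_eq', Finset.mem_univ, if_true]

/-- `#{u : xu + y = xu + t} = p·[y = t]`. -/
theorem sum_ite_line_self (x y t : ZMod p) :
    ∑ u : ZMod p, (if x * u + y = x * u + t then (1 : ℂ) else 0) = if y = t then (p : ℂ) else 0 := by
  simp_rw [add_right_inj]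
  split_ifs <;> simp [ZMod.card]

/-- The main term `Σ_{x',z'} (φ(x')+η(z')) Σ_u [g(u,1)ᵀ = (x'u + y₀(x',z'), z')ᵀ]`. -/
def potTerm (φ η : ZMod p → ℂ) (y₀ : ZMod p → ZMod p → ZMod p) (g : GLm p 2) : ℂ :=
  ∑ x' : ZMod p, ∑ z' : ZMod p, (φ x' + η z') *
    ∑ u : ZMod p, (if (g : Mat p 2) * affCol u = bcol (x' * u + y₀ x' z') z' then (1 : ℂ) else 0)

/-- The `η`-term `Σ_{z'} η(z') Σ_{u'} [g(0,1)ᵀ = (u', z')ᵀ]` (`= η(z)` on the Borel). -/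
def etaTerm (η : ZMod p → ℂ) (g : GLm p 2) : ℂ :=
  ∑ z' : ZMod p, η z' *
    ∑ u' : ZMod p, (if (g : Mat p 2) * affCol (0 : ZMod p) = bcol u' z' then (1 : ℂ) else 0)

/-- The `φ`-term `Σ_{x'} φ(x') [g(1,0)ᵀ = (x', 0)ᵀ]` (`= φ(x)` on the Borel). -/
def phiTerm (φ : ZMod p → ℂ) (g : GLm p 2) : ℂ :=
  ∑ x' : ZMod p, φ x' * (if (g : Mat p 2) * bcol (1 : ZMod p) 0 = bcol x' 0 then (1 : ℂ) else 0)

/-- The POTENTIAL TEST FUNCTION `p⁻¹·potTerm − p⁻¹ Σφ − p⁻¹(p−1)·etaTerm + p⁻¹·phiTerm`. -/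
def potFn (φ η : ZMod p → ℂ) (y₀ : ZMod p → ZMod p → ZMod p) (g : GLm p 2) : ℂ :=
  (p : ℂ)⁻¹ * potTerm φ η y₀ g + ((-((p : ℂ)⁻¹ * ∑ x' : ZMod p, φ x')) * (fun _ : GLm p 2 => (1 : ℂ)) g +
    ((-((p : ℂ)⁻¹ * ((p : ℂ) - 1))) * etaTerm η g + (p : ℂ)⁻¹ * phiTerm φ g))

/-- Constants are level-one functions (the mode `M = 0`). -/
theorem const_one_mem_levelSet : (fun _ : GLm p 2 => (1 : ℂ)) ∈ levelSet p 2 1 :=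
  ⟨constCoeff p 2, rankSupp_constCoeff 1, fun g => (fourierFn_constCoeff g).symm⟩

/-- `potTerm` is a level-one function (a combination of frame indicators). -/
theorem potTerm_mem_levelSet (φ η : ZMod p → ℂ) (y₀ : ZMod p → ZMod p → ZMod p) :
    potTerm φ η y₀ ∈ levelSet p 2 1 := by
  refine sum_mem_levelSet Finset.univ _ fun x' _ => sum_mem_levelSet Finset.univ _ fun z' _ => ?_
  exact smul_mem_levelSet (sum_mem_levelSet Finset.univ _ fun u _ =>
    frameIndicator_mem_levelSet (affCol u) (bcol (x' * u + y₀ x' z') z')) _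

/-- `etaTerm` is a level-one function. -/
theorem etaTerm_mem_levelSet (η : ZMod p → ℂ) : etaTerm η ∈ levelSet p 2 1 := by
  refine sum_mem_levelSet Finset.univ _ fun z' _ => ?_
  exact smul_mem_levelSet (sum_mem_levelSet Finset.univ _ fun u' _ =>
    frameIndicator_mem_levelSet (affCol (0 : ZMod p)) (bcol u' z')) _

/-- `phiTerm` is a level-one function. -/
theorem phiTerm_mem_levelSet (φ : ZMod p → ℂ) : phiTerm φ ∈ levelSet p 2 1 := by
  refine sum_mem_levelSet Finset.univ _ fun x' _ => ?_
  exact smul_mem_levelSet (frameIndicator_mem_levelSet (bcol (1 : ZMod p) 0) (bcol x' 0)) _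

/-- `potFn` is a level-one function. -/
theorem potFn_mem_levelSet (φ η : ZMod p → ℂ) (y₀ : ZMod p → ZMod p → ZMod p) :
    potFn φ η y₀ ∈ levelSet p 2 1 :=
  add_mem_levelSet (smul_mem_levelSet (potTerm_mem_levelSet φ η y₀) _)
    (add_mem_levelSet (smul_mem_levelSet const_one_mem_levelSet _)
      (add_mem_levelSet (smul_mem_levelSet (etaTerm_mem_levelSet η) _)
        (smul_mem_levelSet (phiTerm_mem_levelSet φ) _)))

/-- `potTerm` on an upper-triangular `s = [[x,y],[0,z]]`:
`Σφ + p·η(z) + (φ(x)+η(z))·(p[y = y₀(x,z)] − 1)`. -/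
theorem potTerm_upper (φ η : ZMod p → ℂ) (y₀ : ZMod p → ZMod p → ZMod p) (s : GLm p 2)
    (hs : (s : Mat p 2) 1 0 = 0) :
    potTerm φ η y₀ s = (∑ x' : ZMod p, φ x') + (p : ℂ) * η ((s : Mat p 2) 1 1) +
      (φ ((s : Mat p 2) 0 0) + η ((s : Mat p 2) 1 1)) *
        ((if (s : Mat p 2) 0 1 = y₀ ((s : Mat p 2) 0 0) ((s : Mat p 2) 1 1) then (p : ℂ) else 0) - 1) := by
  set x := (s : Mat p 2) 0 0 with hx
  set y := (s : Mat p 2) 0 1 with hy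
  set z := (s : Mat p 2) 1 1 with hz
  unfold potTerm
  simp_rw [mul_affCol_eq_bcol_iff _ hs]
  have hz' : ∀ x' z' : ZMod p, (∑ u : ZMod p, (if x * u + y = x' * u + y₀ x' z' ∧ z = z' then (1 : ℂ) else 0))
      = if z = z' then ∑ u : ZMod p, (if x * u + y = x' * u + y₀ x' z' then (1 : ℂ) else 0) else 0 := by
    intro x' z'
    split_ifs with h
    · simp [h]
    · simp [h]
  simp_rw [← hx, ← hy, ← hz, hz', mul_ite, mul_zero, Finset.sum_ite_eq, Finset.mem_univ, if_true]
  have hcnt : ∀ x' : ZMod p, (∑ u : ZMod p, (if x * u + y = x' * u + y₀ x' z then (1 : ℂ) else 0)) =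
      if x' = x then (if y = y₀ x z then (p : ℂ) else 0) else 1 := by
    intro x'
    split_ifs with h
    · rw [h]; exact (sum_ite_line_self x y (y₀ x z)).trans (if_pos ‹_›)
    · rw [h]; exact (sum_ite_line_self x y (y₀ x z)).trans (if_neg ‹_›)
    · exact sum_ite_line_of_ne (Ne.symm h) y (y₀ x' z)
  simp_rw [hcnt]
  have hsplit : ∀ x' : ZMod p, (φ x' + η z) * (if x' = x then (if y = y₀ x z then (p : ℂ) else 0) else 1) =
      (φ x' + η z) + (if x' = x then (φ x' + η z) *
        ((if y = y₀ x z then (p : ℂ) else 0) - 1) else 0) := by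
    intro x'
    split_ifs <;> ring
  simp_rw [hsplit, Finset.sum_add_distrib, Finset.sum_ite_eq', Finset.mem_univ, if_true,
    Finset.sum_const, Finset.card_univ, ZMod.card, nsmul_eq_mul]

/-- `etaTerm` on an upper-triangular `s`: `η(z)`. -/
theorem etaTerm_upper (η : ZMod p → ℂ) (s : GLm p 2) (hs : (s : Mat p 2) 1 0 = 0) :
    etaTerm η s = η ((s : Mat p 2) 1 1) := by
  unfold etaTerm
  simp_rw [mul_affCol_eq_bcol_iff _ hs, mul_zero, zero_add]
  have h : ∀ z' : ZMod p, (∑ u' : ZMod p, (if (s : Mat p 2) 0 1 = u' ∧ (s : Mat p 2) 1 1 = z'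
      then (1 : ℂ) else 0)) = if (s : Mat p 2) 1 1 = z' then 1 else 0 := by
    intro z'
    split_ifs with hz
    · simp [hz, Finset.sum_ite_eq]
    · simp [hz]
  simp_rw [h, mul_ite, mul_one, mul_zero, Finset.sum_ite_eq, Finset.mem_univ, if_true]

/-- `phiTerm` on an upper-triangular `s`: `φ(x)`. -/
theorem phiTerm_upper (φ : ZMod p → ℂ) (s : GLm p 2) (hs : (s : Mat p 2) 1 0 = 0) :
    phiTerm φ s = φ ((s : Mat p 2) 0 0) := by
  unfold phiTerm
  simp_rw [mul_bcol_eq_iff _ hs, mul_ite, mul_one, mul_zero, Finset.sum_ite_eq, Finset.mem_univ,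
    if_true]

/-- **The potential test function on the Borel**: `f(s) = (φ(x) + η(z))·[y = y₀(x,z)]`. -/
theorem potFn_upper (φ η : ZMod p → ℂ) (y₀ : ZMod p → ZMod p → ZMod p) (s : GLm p 2)
    (hs : (s : Mat p 2) 1 0 = 0) :
    potFn φ η y₀ s = (φ ((s : Mat p 2) 0 0) + η ((s : Mat p 2) 1 1)) *
      (if (s : Mat p 2) 0 1 = y₀ ((s : Mat p 2) 0 0) ((s : Mat p 2) 1 1) then 1 else 0) := by
  have hp : (p : ℂ) ≠ 0 := Nat.cast_ne_zero.mpr (Fact.out : p.Prime).ne_zero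
  unfold potFn
  rw [potTerm_upper φ η y₀ s hs, etaTerm_upper η s hs, phiTerm_upper φ s hs]
  split_ifs
  · field_simp
    ring
  · field_simp
    ring

/-- **THE POTENTIAL CRITERION (Theorem H, PASS direction).**  Let `S` consist of upper-triangular
elements of `GL₂(𝔽_p)`.  Given `φ, η` with `φ(1) + η(1) = 1` and a section `y₀` with `y₀(1,1) = 0` such
that every `s = [[x,y],[0,z]] ∈ S ∖ {1}` with `y = y₀(x,z)` has `φ(x) + η(z) = 0`, the set `S` passes
the level-one identity test. -/
theorem idTest_of_borel_potential (S : Set (GLm p 2)) (hS : ∀ s ∈ S, (s : Mat p 2) 1 0 = 0)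
    (φ η : ZMod p → ℂ) (y₀ : ZMod p → ZMod p → ZMod p) (hy₀ : y₀ 1 1 = 0) (hΦ : φ 1 + η 1 = 1)
    (hpot : ∀ s ∈ S, s ≠ 1 → (s : Mat p 2) 0 1 = y₀ ((s : Mat p 2) 0 0) ((s : Mat p 2) 1 1) →
      φ ((s : Mat p 2) 0 0) + η ((s : Mat p 2) 1 1) = 0) :
    ∃ c : Mat p 2 → ℂ, RankSupp 1 c ∧ fourierFn c 1 = 1 ∧ ∀ s ∈ S, s ≠ 1 → fourierFn c s = 0 := by
  obtain ⟨c, hc, hcf⟩ := potFn_mem_levelSet (p := p) φ η y₀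
  have h1u : ((1 : GLm p 2) : Mat p 2) = 1 := Units.val_one
  have e00 : ((1 : GLm p 2) : Mat p 2) 0 0 = 1 := by rw [h1u]; exact Matrix.one_apply_eq 0
  have e01 : ((1 : GLm p 2) : Mat p 2) 0 1 = 0 := by rw [h1u]; exact Matrix.one_apply_ne (by decide)
  have e10 : ((1 : GLm p 2) : Mat p 2) 1 0 = 0 := by rw [h1u]; exact Matrix.one_apply_ne (by decide)
  have e11 : ((1 : GLm p 2) : Mat p 2) 1 1 = 1 := by rw [h1u]; exact Matrix.one_apply_eq 1
  refine ⟨c, hc, ?_, fun s hs hs1 => ?_⟩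
  · rw [← hcf, potFn_upper φ η y₀ 1 e10, e00, e01, e11, hy₀, if_pos rfl, mul_one, hΦ]
  · rw [← hcf, potFn_upper φ η y₀ s (hS s hs)]
    split_ifs with h
    · rw [hpot s hs hs1 h, zero_mul]
    · rw [mul_zero]

/-- **The identity-design clause of the crux HOLDS for Borel triples admitting a potential**
(`m = 2`, `k = 1`), in the literal shape of the second clause of `SubgroupIdentityDesigns`. -/
theorem levelOne_idDesign_of_borel_potential
    {H₁ H₂ H₃ : Subgroup (Matrix.GeneralLinearGroup (Fin 2) (ZMod p))}
    (h₁ : ∀ a ∈ H₁, (a : Mat p 2) 1 0 = 0) (h₂ : ∀ b ∈ H₂, (b : Mat p 2) 1 0 = 0)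
    (h₃ : ∀ g ∈ H₃, (g : Mat p 2) 1 0 = 0)
    (φ η : ZMod p → ℂ) (y₀ : ZMod p → ZMod p → ZMod p) (hy₀ : y₀ 1 1 = 0) (hΦ : φ 1 + η 1 = 1)
    (hpot : ∀ a ∈ H₁, ∀ b ∈ H₂, ∀ g ∈ H₃, a * b * g ≠ 1 →
      ((a * b * g : GLm p 2) : Mat p 2) 0 1 =
        y₀ (((a * b * g : GLm p 2) : Mat p 2) 0 0) (((a * b * g : GLm p 2) : Mat p 2) 1 1) →
      φ (((a * b * g : GLm p 2) : Mat p 2) 0 0) + η (((a * b * g : GLm p 2) : Mat p 2) 1 1) = 0) :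
    ∃ c : Mat p 2 → ℂ, (∀ M : Mat p 2, 1 < M.rank → c M = 0) ∧
      (∑ M : Mat p 2, c M * ZMod.stdAddChar (Matrix.trace
        (M * ((1 : Matrix.GeneralLinearGroup (Fin 2) (ZMod p)) : Mat p 2)))) = 1 ∧
      ∀ a ∈ H₁, ∀ b ∈ H₂, ∀ g ∈ H₃, a * b * g ≠ 1 →
        (∑ M : Mat p 2, c M * ZMod.stdAddChar (Matrix.trace
          (M * ((a * b * g : Matrix.GeneralLinearGroup (Fin 2) (ZMod p)) : Mat p 2)))) = 0 := by
  let S : Set (GLm p 2) := {s | ∃ a ∈ H₁, ∃ b ∈ H₂, ∃ g ∈ H₃, s = a * b * g}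
  have hS : ∀ s ∈ S, (s : Mat p 2) 1 0 = 0 := by
    rintro s ⟨a, ha, b, hb, g, hg, rfl⟩
    exact upper_mul (upper_mul (h₁ a ha) (h₂ b hb)) (h₃ g hg)
  have hpotS : ∀ s ∈ S, s ≠ 1 → (s : Mat p 2) 0 1 = y₀ ((s : Mat p 2) 0 0) ((s : Mat p 2) 1 1) →
      φ ((s : Mat p 2) 0 0) + η ((s : Mat p 2) 1 1) = 0 := by
    rintro s ⟨a, ha, b, hb, g, hg, rfl⟩ hs1 hsec
    exact hpot a ha b hb g hg hs1 hsec
  obtain ⟨c, hc, hc1, hc0⟩ := idTest_of_borel_potential S hS φ η y₀ hy₀ hΦ hpotS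
  refine ⟨c, hc, ?_, fun a ha b hb g hg hne => ?_⟩
  · simpa [fourierFn] using hc1
  · simpa [fourierFn] using hc0 (a * b * g) ⟨a, ha, b, hb, g, hg, rfl⟩ hne

end Potential

end Summit.MatrixMultiplication.MatrixMultiplication.Theorems.SubgroupIdentityDesigns.Negative

end
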